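import Summits.Ventures.PercRepro.C041TriDomGlueClasses

/-!
# ROW C-041 — THE CYCLE HOST: connectivity between two vertices of a cycle is a monochromatic arc
(p6, gen 45; P6-TWOEXIT-LEAN.md §53 ADDENDUM 16, THEOREM (CYCLES))

The cycle on `m + 1` vertices (`cycleHost m`: vertices and edges `Fin (m + 1)`, the edge `i` joining `i` and
`i + 1`).  `Mono c lo hi ω` says that every edge with index in `[lo, hi)` has the colour `c`.  **THE ARC LEMMA**
(`rtg_cycle_iff`): for `u < v` (as numbers), `u` and `v` are joined by a walk of colour `c` iff the arc `[u, v)`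
or the complementary arc `[v, m + 1) ∪ [0, u)` is all of colour `c` — by walking along an arc (`rtg_up`, the
wrap-around edge `m` joining `m` and `0`), and, conversely, by THE CUT LEMMAS (`rtg_two_cuts_outer` /
`_inner`): two edges of the other colour, one on each arc, confine every walk of colour `c` to one of the two
pieces they cut the cycle into.  Specialised to the all-free red / blue connectivities in
`RdS_cycle_iff` / `MgS_cycle_iff`.
-/

namespace PercRepro

namespace ZoneZ

namespace MultiExit

open ZoneData Finset GlueB

/-- The cycle host on `m + 1` vertices: the edge `i` joins `i` and `i + 1`. -/
def cycleHost (m : ℕ) : ZoneData (Fin (m + 1)) (Fin (m + 1)) Empty Empty where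
  fst := id
  snd := fun i => i + 1
  at₁ := Empty.elim
  at₂ := Empty.elim

variable {m : ℕ}

/-- An edge joins its index and its successor. -/
theorem cycle_joins_iff (e x y : Fin (m + 1)) :
    (cycleHost m).Joins e x y ↔ (e = x ∧ e + 1 = y) ∨ (e = y ∧ e + 1 = x) := Iff.rfl

/-- The value of the successor: `0` after the last vertex, `i + 1` otherwise. -/
theorem val_succ (i : Fin (m + 1)) : (i + 1).val = if i.val = m then 0 else i.val + 1 := by
  rw [Fin.val_add_one]
  by_cases h : i = Fin.last m
  · rw [if_pos h, if_pos (by rw [h, Fin.val_last])]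
  · rw [if_neg h, if_neg (fun hv => h (Fin.ext (by rw [hv, Fin.val_last])))]

/-- Adjacency through an edge of colour `c`. -/
def cadj (c : Bool) (ω : Fin (m + 1) → Bool) (x y : Fin (m + 1)) : Prop :=
  ∃ e, (cycleHost m).Joins e x y ∧ ω e = c

/-- All edges with index in `[lo, hi)` have the colour `c`. -/
def Mono (c : Bool) (lo hi : ℕ) (ω : Fin (m + 1) → Bool) : Prop :=
  ∀ i : Fin (m + 1), lo ≤ i.val → i.val < hi → ω i = c

/-! ## The cut lemmas -/

/-- A step of colour `c` cannot cross the edges `i₁ < i₂` of the other colour: it stays in the outer piece. -/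
theorem step_outer (c : Bool) (ω : Fin (m + 1) → Bool) {i₁ i₂ : Fin (m + 1)} (h₁ : ω i₁ ≠ c) (h₂ : ω i₂ ≠ c)
    (hlt : i₁.val < i₂.val) {a b : Fin (m + 1)} (ha : a.val ≤ i₁.val ∨ i₂.val < a.val) (hab : cadj c ω a b) :
    b.val ≤ i₁.val ∨ i₂.val < b.val := by
  obtain ⟨e, hj, hc⟩ := hab
  have hj' : (e = a ∧ e + 1 = b) ∨ (e = b ∧ e + 1 = a) := hj
  have hne₁ : e.val ≠ i₁.val := fun h => h₁ (by rw [← Fin.ext h]; exact hc)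
  have hne₂ : e.val ≠ i₂.val := fun h => h₂ (by rw [← Fin.ext h]; exact hc)
  have hs := val_succ e
  have he := e.isLt
  have hi₂ := i₂.isLt
  rcases hj' with ⟨rfl, rfl⟩ | ⟨rfl, rfl⟩
  · split_ifs at hs with hm <;> omega
  · split_ifs at hs with hm <;> omega

/-- A step of colour `c` cannot cross the edges `i₁ < i₂` of the other colour: it stays in the inner piece. -/
theorem step_inner (c : Bool) (ω : Fin (m + 1) → Bool) {i₁ i₂ : Fin (m + 1)} (h₁ : ω i₁ ≠ c) (h₂ : ω i₂ ≠ c)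
    (hlt : i₁.val < i₂.val) {a b : Fin (m + 1)} (ha : i₁.val < a.val ∧ a.val ≤ i₂.val) (hab : cadj c ω a b) :
    i₁.val < b.val ∧ b.val ≤ i₂.val := by
  obtain ⟨e, hj, hc⟩ := hab
  have hj' : (e = a ∧ e + 1 = b) ∨ (e = b ∧ e + 1 = a) := hj
  have hne₁ : e.val ≠ i₁.val := fun h => h₁ (by rw [← Fin.ext h]; exact hc)
  have hne₂ : e.val ≠ i₂.val := fun h => h₂ (by rw [← Fin.ext h]; exact hc)
  have hs := val_succ e
  have he := e.isLt
  have hi₂ := i₂.isLt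
  rcases hj' with ⟨rfl, rfl⟩ | ⟨rfl, rfl⟩
  · split_ifs at hs with hm <;> omega
  · split_ifs at hs with hm <;> omega

/-- **THE CUT LEMMA (outer piece)**. -/
theorem rtg_two_cuts_outer (c : Bool) (ω : Fin (m + 1) → Bool) {i₁ i₂ : Fin (m + 1)} (h₁ : ω i₁ ≠ c)
    (h₂ : ω i₂ ≠ c) (hlt : i₁.val < i₂.val) {s w : Fin (m + 1)} (hs : s.val ≤ i₁.val ∨ i₂.val < s.val)
    (h : Relation.ReflTransGen (cadj c ω) s w) : w.val ≤ i₁.val ∨ i₂.val < w.val := by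
  induction h with
  | refl => exact hs
  | tail _ hab ih => exact step_outer c ω h₁ h₂ hlt ih hab

/-- **THE CUT LEMMA (inner piece)**. -/
theorem rtg_two_cuts_inner (c : Bool) (ω : Fin (m + 1) → Bool) {i₁ i₂ : Fin (m + 1)} (h₁ : ω i₁ ≠ c)
    (h₂ : ω i₂ ≠ c) (hlt : i₁.val < i₂.val) {s w : Fin (m + 1)} (hs : i₁.val < s.val ∧ s.val ≤ i₂.val)
    (h : Relation.ReflTransGen (cadj c ω) s w) : i₁.val < w.val ∧ w.val ≤ i₂.val := by
  induction h with
  | refl => exact hs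
  | tail _ hab ih => exact step_inner c ω h₁ h₂ hlt ih hab

/-! ## Walking along an arc -/

/-- The vertex with a given value. -/
def vtx (k : ℕ) (hk : k ≤ m) : Fin (m + 1) := ⟨k, Nat.lt_succ_of_le hk⟩

/-- The successor of a vertex below the last one. -/
theorem vtx_succ (k : ℕ) (hk : k + 1 ≤ m) : vtx k (Nat.le_of_succ_le hk) + 1 = vtx (k + 1) hk := by
  apply Fin.ext
  rw [val_succ]
  simp only [vtx]
  rw [if_neg (by omega)]

/-- The successor of the last vertex is `0`. -/
theorem last_succ : vtx m le_rfl + 1 = (0 : Fin (m + 1)) := by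
  apply Fin.ext
  rw [val_succ]
  simp [vtx]

/-- Walking up an arc of colour `c`. -/
theorem rtg_up (c : Bool) (ω : Fin (m + 1) → Bool) (lo : ℕ) :
    ∀ hi : ℕ, ∀ hle : lo ≤ hi, ∀ hhi : hi ≤ m, Mono c lo hi ω →
      Relation.ReflTransGen (cadj c ω) (vtx lo (le_trans hle hhi)) (vtx hi hhi) := by
  intro hi hle
  induction hi, hle using Nat.le_induction with
  | base => intro _ _; exact Relation.ReflTransGen.refl
  | succ k hlk ih =>
    intro hk hmono
    have hmono' : Mono c lo k ω := fun i h1 h2 => hmono i h1 (by omega)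
    refine (ih (Nat.le_of_succ_le hk) hmono').tail ?_
    refine ⟨vtx k (Nat.le_of_succ_le hk), Or.inl ⟨rfl, vtx_succ k hk⟩, ?_⟩
    exact hmono _ hlk (by simp [vtx])

/-- The colour-`c` walks form a symmetric relation. -/
theorem cadj_symm (c : Bool) (ω : Fin (m + 1) → Bool) (x y : Fin (m + 1)) (h : cadj c ω x y) : cadj c ω y x := by
  obtain ⟨e, hj, hc⟩ := h
  exact ⟨e, Joins_symm _ hj, hc⟩

/-- **THE ARC LEMMA**: for `u < v`, a walk of colour `c` joins them iff the arc `[u, v)` or the complementary arc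
is all of colour `c`. -/
theorem rtg_cycle_iff (c : Bool) (ω : Fin (m + 1) → Bool) {u v : Fin (m + 1)} (huv : u.val < v.val) :
    Relation.ReflTransGen (cadj c ω) u v ↔
      Mono c u.val v.val ω ∨ (Mono c 0 u.val ω ∧ Mono c v.val (m + 1) ω) := by
  constructor
  · intro h
    by_contra hcon
    rw [not_or, not_and_or] at hcon
    obtain ⟨hA, hB⟩ := hcon
    unfold Mono at hA
    push Not at hA
    obtain ⟨i₁, hu₁, hv₁, hc₁⟩ := hA
    rcases hB with hB | hB
    · unfold Mono at hB
      push Not at hB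
      obtain ⟨i₂, _, hu₂, hc₂⟩ := hB
      -- `i₂ < u ≤ i₁ < v`: the inner piece of the cuts `(i₂, i₁)` contains `u` but not `v`
      have := rtg_two_cuts_inner c ω hc₂ hc₁ (by omega) (s := u) ⟨by omega, by omega⟩ h
      omega
    · unfold Mono at hB
      push Not at hB
      obtain ⟨i₂, hv₂, _, hc₂⟩ := hB
      -- `u ≤ i₁ < v ≤ i₂`: the outer piece of the cuts `(i₁, i₂)` contains `u` but not `v`
      have := rtg_two_cuts_outer c ω hc₁ hc₂ (by omega) (s := u) (Or.inl (by omega)) h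
      omega
  · intro h
    have hv := v.isLt
    rcases h with h | ⟨h0, h1⟩
    · have := rtg_up c ω u.val v.val (le_of_lt huv) (Nat.le_of_lt_succ hv) h
      simpa [vtx] using this
    · -- `u` down to `0`, `v` up to `m`, the edge `m` to `0`
      have hu0 := rtg_up c ω 0 u.val (Nat.zero_le _) (by omega) h0
      have hvm := rtg_up c ω v.val m (Nat.le_of_lt_succ hv) le_rfl (fun i hi1 _ => h1 i hi1 (by omega))
      have hm0 : cadj c ω (vtx m le_rfl) 0 :=
        ⟨vtx m le_rfl, Or.inl ⟨rfl, last_succ⟩, h1 _ (by simp [vtx]; omega) (by simp [vtx])⟩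
      have h1' : Relation.ReflTransGen (cadj c ω) u (0 : Fin (m + 1)) := by
        have := rtg_symm (cadj_symm c ω) hu0
        simpa [vtx] using this
      have h2' : Relation.ReflTransGen (cadj c ω) (0 : Fin (m + 1)) v := by
        have := rtg_symm (cadj_symm c ω) (hvm.tail hm0)
        simpa [vtx] using this
      exact h1'.trans h2'

/-! ## The all-free connectivities of the cycle host -/

/-- Red adjacency of the all-free status is adjacency through a red edge. -/
theorem RAdjS_cycle (ω : Fin (m + 1) → Bool) :
    RAdjS (cycleHost m) (fun _ => EStat.free) ω = cadj true ω := by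
  funext x y
  refine propext (exists_congr fun e => and_congr_right fun _ => ?_)
  exact redE_free ω e

/-- Blue adjacency of the all-free status is adjacency through a blue edge. -/
theorem BAdjS_cycle (ω : Fin (m + 1) → Bool) :
    BAdjS (cycleHost m) (fun _ => EStat.free) ω = cadj false ω := by
  funext x y
  refine propext (exists_congr fun e => and_congr_right fun _ => ?_)
  exact blueE_free ω e

/-- Red connectivity on the cycle: a red arc. -/
theorem RdS_cycle_iff (ω : Fin (m + 1) → Bool) {u v : Fin (m + 1)} (huv : u.val < v.val) :
    RdS (cycleHost m) (fun _ => EStat.free) ω u v ↔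
      Mono true u.val v.val ω ∨ (Mono true 0 u.val ω ∧ Mono true v.val (m + 1) ω) := by
  unfold RdS
  rw [mem_reach_singleton, RAdjS_cycle]
  exact rtg_cycle_iff true ω huv

/-- Blue connectivity on the cycle: a blue arc. -/
theorem MgS_cycle_iff (ω : Fin (m + 1) → Bool) {u v : Fin (m + 1)} (huv : u.val < v.val) :
    MgS (cycleHost m) (fun _ => EStat.free) ω u v ↔
      Mono false u.val v.val ω ∨ (Mono false 0 u.val ω ∧ Mono false v.val (m + 1) ω) := by
  unfold MgS
  rw [mem_reach_singleton, BAdjS_cycle]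
  exact rtg_cycle_iff false ω huv

end MultiExit

end ZoneZ

end PercRepro
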